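import Summits.Ventures.PackingBounds.ThreePointCert.CheckDim3

/-!
# Soundness of the `S²` (`n = 3`) three-point certificate checker

Framing: lottery ticket; floor = certified bounds/negative ranges. Venture `PackingBounds`
(cell `pub-packcert`), three-point SDP family.

The checks of `ThreePointCert.CheckDim3` (three-point part with the Chebyshev kernels `Q3`,
validity `PolysOK33`, side conditions `checkSide33`) together with the reused general checks
`checkI3` (`Check`), `checkII3S2` (`CheckSym2`, Bachoc–Vallentin's multiplier set) and `checkBound3`
imply the bound: `FII33S2_of_check` (`(ii')` on the domain `D'`), `AF33_of_check` (`(i')` on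
`[-1, s]`), `bound33_of_check`, and the final **`card_le_of_cert33S2`** — every finite set of unit
vectors of `ℝ³` with pairwise inner products `≤ p/q` has at most `N` elements (Bachoc–Vallentin,
Theorem 4.2 with `n = 3`, via `BachocVallentin.card_le_of_threePoint` and the `S²` positivity of
`ThreePointKernelDimThree`). The proofs are the `n ≥ 4` proofs of `Soundness`/`CheckSym2` with
`FPolyG`/`FvalG` replaced by `FPoly3`/`Fval3`.

## References
* C. Bachoc, F. Vallentin, J. Amer. Math. Soc. 21 (2008) 909–924, Theorem 4.2. [`BachocVallentin2007`]
* C. Bachoc, F. Vallentin, ISIT 2007, Table 5.3 (Tammes bounds). [`BachocVallentin2007ISIT`]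
-/

noncomputable section

open Finset
open scoped RealInnerProductSpace

namespace Summit.Ventures.PackingBounds.ThreePointCert

open Literature.Geometry.DiscreteGeometry Literature.Geometry.DiscreteGeometry.PolyCert
open Literature.Geometry.DiscreteGeometry.PolyCert.SPoly
open Literature.Analysis.SpecialFunctions

/-! ### Soundness of the checks on `S²` -/

set_option maxHeartbeats 4000000 in
/-- Soundness of `(ii')` on `S²` (Bachoc–Vallentin multiplier set, `checkII3S2`): on `D'`,
`F ≤ -b₂₂` (in units: `Fval3/D² ≤ -B22/(D²W)`). -/
theorem FII33S2_of_check (c : Cert3) (P : CertPolys3) {g0 g1 g2 g3 g4 q0 q1 : GramBlk}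
    (hP : PolysOK33 c P g0 g1 g2 g3 g4 q0 q1) (h : checkII3S2 c P = true)
    (hs : checkSide33 c = true) (u v t : ℝ)
    (hu : -1 ≤ u) (hu' : u ≤ (c.p : ℝ) / c.q) (hv : -1 ≤ v) (hv' : v ≤ (c.p : ℝ) / c.q)
    (ht : -1 ≤ t) (ht' : t ≤ (c.p : ℝ) / c.q)
    (hp : 0 ≤ 1 + 2 * u * v * t - u ^ 2 - v ^ 2 - t ^ 2) :
    Fval3 c.F u v t / 2 ^ (2 * c.S) ≤ -((c.B22 : ℝ) / c.DDW) := by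
  obtain ⟨hn, hq, hpq, _, hAlen, hFk, _⟩ := side33_of_check c hs
  have hu1 := abs_le_one_of_box c.p c.q hq hpq u hu hu'
  have hv1 := abs_le_one_of_box c.p c.q hq hpq v hv hv'
  have ht1 := abs_le_one_of_box c.p c.q hq hpq t ht ht'
  have hres := abs_eval_le_of_residualBound _ _ h hu1 hv1 ht1
  rw [eval_mergeAll] at hres
  simp only [List.map_cons, List.map_nil, List.sum_cons, List.sum_nil, add_zero, eval_neg, eval_C,
    Int.cast_natCast] at hres
  have hrhs : 0 ≤ eval (rhsII3S2 c P) u v t := by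
    -- the right-hand side only involves the Gram blocks; reuse the general lemma with a dummy `hF`
    -- is not possible (different predicate), so repeat the short argument
    have gu := gq_nonneg c.p c.q u hu (qmul_le_of_box c.p c.q hq u hu')
    have gv := gq_nonneg c.p c.q v hv (qmul_le_of_box c.p c.q hq v hv')
    have gt := gq_nonneg c.p c.q t ht (qmul_le_of_box c.p c.q hq t ht')
    have e0 := eval_nonneg_of_rvalid g0 P.E0 hP.h0 u v t hu1 hv1 ht1
    have e1 := eval_nonneg_of_rvalid g1 P.E1 hP.h1 u v t hu1 hv1 ht1
    have e1' := eval_nonneg_of_rvalid g1 P.E1 hP.h1 v u t hv1 hu1 ht1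
    have e1'' := eval_nonneg_of_rvalid g1 P.E1 hP.h1 t v u ht1 hv1 hu1
    have e2 := eval_nonneg_of_rvalid g2 P.E2 hP.h2 u v t hu1 hv1 ht1
    have e3 := eval_nonneg_of_rvalid g3 P.E3 hP.h3 u v t hu1 hv1 ht1
    have e4 := eval_nonneg_of_rvalid g4 P.E4 hP.h4 u v t hu1 hv1 ht1
    rw [rhsII3S2, eval_mergeAll]
    simp only [List.map_cons, List.map_nil, List.sum_cons, List.sum_nil, add_zero, eval_mulN,
      eval_permBAC, eval_permCBA, eval_gE1, eval_m2P, eval_m3P, eval_p4]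
    generalize eval P.E0 u v t = r0 at *
    generalize eval P.E1 u v t = r1 at *
    generalize eval P.E1 v u t = r1' at *
    generalize eval P.E1 t v u = r1'' at *
    generalize eval P.E2 u v t = r2 at *
    generalize eval P.E3 u v t = r3 at *
    generalize eval P.E4 u v t = r4 at *
    generalize (u + 1) * ((c.p : ℝ) - c.q * u) = a1 at *
    generalize (v + 1) * ((c.p : ℝ) - c.q * v) = a2 at *
    generalize (t + 1) * ((c.p : ℝ) - c.q * t) = a3 at *
    have m12 := mul_nonneg gu gv
    have m13 := mul_nonneg gu gt
    have m23 := mul_nonneg gv gt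
    have m123 := mul_nonneg gu (mul_nonneg gv gt)
    nlinarith [mul_nonneg gu e1, mul_nonneg gv e1', mul_nonneg gt e1'', mul_nonneg m12 e2,
      mul_nonneg m13 e2, mul_nonneg m23 e2, mul_nonneg m123 e3, mul_nonneg hp e4]
  generalize hR : eval (rhsII3S2 c P) u v t = R at hres hrhs
  have htgt : 0 ≤ eval (targetII3 c P) u v t := by
    have h1 := (abs_le.1 hres).1
    linarith
  rw [targetII3, eval_neg, eval_append, eval_C, hP.hF u v t hu1 hv1 ht1,
    eval_FPoly3 c.d c.F hFk] at htgt
  push_cast at htgt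
  have hW : (0 : ℝ) < Wfac c.d := by exact_mod_cast Wfac_pos c.d
  have hD : (0 : ℝ) < 2 ^ (2 * c.S) := pow_pos (by norm_num) _
  have hDDW : (c.DDW : ℝ) = 2 ^ (2 * c.S) * (Wfac c.d : ℝ) := by simp [Cert3.DDW]
  have key : Fval3 c.F u v t * (Wfac c.d : ℝ) ≤ -(c.B22 : ℝ) := by linarith
  rw [hDDW, div_le_iff₀ hD]
  have e : -((c.B22 : ℝ) / (2 ^ (2 * c.S) * Wfac c.d)) * 2 ^ (2 * c.S) = -(c.B22 : ℝ) / Wfac c.d := by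
    field_simp
  rw [e, le_div_iff₀ hW]
  exact key

set_option maxHeartbeats 4000000 in
/-- Soundness of `(i')` on `S²`: on `[-1, s]`, `A(u) + 3F(u,u,1) ≤ -1 - 2b₁₂ - b₂₂` (in units). -/
theorem AF33_of_check (c : Cert3) (P : CertPolys3) {g0 g1 g2 g3 g4 q0 q1 : GramBlk}
    (hP : PolysOK33 c P g0 g1 g2 g3 g4 q0 q1) (h : checkI3 c P = true) (hs : checkSide33 c = true)
    (u : ℝ) (hu : -1 ≤ u) (hu' : u ≤ (c.p : ℝ) / c.q) :
    AvalG c.n c.A u / 2 ^ (2 * c.S) + 3 * (Fval3 c.F u u 1 / 2 ^ (2 * c.S)) ≤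
      -1 - 2 * ((c.B12 : ℝ) / c.DDW) - (c.B22 : ℝ) / c.DDW := by
  obtain ⟨hn, hq, hpq, _, hAlen, hFk, _⟩ := side33_of_check c hs
  have hu1 := abs_le_one_of_box c.p c.q hq hpq u hu hu'
  have h01 : |(0 : ℝ)| ≤ 1 := by norm_num
  have h11 : |(1 : ℝ)| ≤ 1 := by norm_num
  have gu := gq_nonneg c.p c.q u hu (qmul_le_of_box c.p c.q hq u hu')
  have hres := abs_eval_le_of_residualBound _ _ h hu1 h01 h01
  rw [eval_mergeAll] at hres
  simp only [List.map_cons, List.map_nil, List.sum_cons, List.sum_nil, add_zero, eval_neg, eval_C,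
    Int.cast_natCast] at hres
  have hrhs : 0 ≤ eval (rhsI3 c P) u 0 0 := by
    have e0 := eval_nonneg_of_rvalid q0 P.EQ0 hP.hq0 u 0 0 hu1 h01 h01
    have e1 := eval_nonneg_of_rvalid q1 P.EQ1 hP.hq1 u 0 0 hu1 h01 h01
    rw [rhsI3, eval_mergeAll]
    simp only [List.map_cons, List.map_nil, List.sum_cons, List.sum_nil, add_zero, eval_mulN,
      eval_gqU]
    nlinarith [mul_nonneg gu e1]
  generalize hR : eval (rhsI3 c P) u 0 0 = R at hres hrhs
  have htgt : 0 ≤ eval (targetI3 c P) u 0 0 := by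
    have h1 := (abs_le.1 hres).1
    linarith
  have hFss : eval (substUU1 P.FP) u 0 0 = (Wfac c.d : ℝ) * Fval3 c.F u u 1 := by
    rw [eval_substUU1, hP.hF u u 1 hu1 hu1 h11, eval_FPoly3 c.d c.F hFk]
  rw [targetI3, eval_neg, eval_append, eval_append, eval_C, eval_smul, hFss,
    eval_APolyG c.n c.d c.A hAlen.le] at htgt
  push_cast at htgt
  have hW : (0 : ℝ) < Wfac c.d := by exact_mod_cast Wfac_pos c.d
  have hD : (0 : ℝ) < 2 ^ (2 * c.S) := pow_pos (by norm_num) _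
  have hDDW : (c.DDW : ℝ) = 2 ^ (2 * c.S) * (Wfac c.d : ℝ) := by simp [Cert3.DDW]
  rw [hDDW] at htgt ⊢
  have hDW : (0 : ℝ) < 2 ^ (2 * c.S) * (Wfac c.d : ℝ) := mul_pos hD hW
  generalize hAv : AvalG c.n c.A u = AV at htgt ⊢
  generalize hFv : Fval3 c.F u u 1 = FV at htgt ⊢
  have key : (Wfac c.d : ℝ) * (AV + 3 * FV) ≤
      -(2 ^ (2 * c.S) * (Wfac c.d : ℝ)) - 2 * (c.B12 : ℝ) - (c.B22 : ℝ) := by linarith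
  have lhs_eq : AV / 2 ^ (2 * c.S) + 3 * (FV / 2 ^ (2 * c.S)) =
      ((Wfac c.d : ℝ) * (AV + 3 * FV)) / (2 ^ (2 * c.S) * Wfac c.d) := by
    field_simp
  have rhs_eq : -1 - 2 * ((c.B12 : ℝ) / (2 ^ (2 * c.S) * Wfac c.d)) - (c.B22 : ℝ) / (2 ^ (2 * c.S) * Wfac c.d)
      = (-(2 ^ (2 * c.S) * (Wfac c.d : ℝ)) - 2 * (c.B12 : ℝ) - (c.B22 : ℝ)) / (2 ^ (2 * c.S) * Wfac c.d) := by
    field_simp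
  rw [lhs_eq, rhs_eq]
  exact div_le_div_of_nonneg_right key hDW.le

/-- The `b`-matrix is positive semidefinite as a quadratic (`S²` side conditions). -/
theorem bquad33_nonneg_of_check (c : Cert3) (hs : checkSide33 c = true) (l : ℝ) :
    0 ≤ (c.B11 : ℝ) / c.DDW + 2 * ((c.B12 : ℝ) / c.DDW) * l + (c.B22 : ℝ) / c.DDW * l ^ 2 := by
  obtain ⟨_, _, _, _, _, _, hdet⟩ := side33_of_check c hs
  have hdet' : (c.B12 : ℝ) * c.B12 ≤ (c.B11 : ℝ) * c.B22 := by exact_mod_cast hdet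
  have hDDW : (0 : ℝ) < c.DDW := by
    have : 0 < c.DDW := by unfold Cert3.DDW; exact Nat.mul_pos (Nat.two_pow_pos _) (Wfac_pos c.d)
    exact_mod_cast this
  refine BachocVallentin.quad_nonneg_of_psd2 _ _ _ (by positivity) (by positivity) ?_ l
  rw [div_pow, div_mul_div_comm, sq, sq]
  exact div_le_div_of_nonneg_right hdet' (by positivity)

/-- The bound is `< N + 1` and `≥ 0` when `checkBound3` succeeds (`S²` version). -/
theorem bound33_of_check (c : Cert3) (P : CertPolys3) (hF : FexpValid3 c P.FP)
    (hs : checkSide33 c = true) (h : checkBound3 c P = true) :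
    1 + AvalG c.n c.A 1 / 2 ^ (2 * c.S) + (c.B11 : ℝ) / c.DDW + Fval3 c.F 1 1 1 / 2 ^ (2 * c.S)
        < (c.N : ℝ) + 1 ∧
      0 ≤ 1 + AvalG c.n c.A 1 / 2 ^ (2 * c.S) + (c.B11 : ℝ) / c.DDW + Fval3 c.F 1 1 1 / 2 ^ (2 * c.S) := by
  obtain ⟨hn, hq, hpq, _, hAlen, hFk, _⟩ := side33_of_check c hs
  simp only [checkBound3, Bool.and_eq_true, decide_eq_true_eq] at h
  obtain ⟨hlt, hge⟩ := h
  have h11 : |(1 : ℝ)| ≤ 1 := by norm_num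
  have hAv : (coeffSum (APolyG c.n c.d c.A) : ℝ) = (Wfac c.d : ℝ) * AvalG c.n c.A 1 := by
    rw [← eval_one_one_one, eval_APolyG c.n c.d c.A hAlen.le]
  have hFv : (coeffSum P.FP : ℝ) = (Wfac c.d : ℝ) * Fval3 c.F 1 1 1 := by
    rw [← eval_one_one_one, hF 1 1 1 h11 h11 h11, eval_FPoly3 c.d c.F hFk]
  have hlt' : ((c.DDW : ℝ) + (coeffSum (APolyG c.n c.d c.A) : ℝ) + c.B11 + (coeffSum P.FP : ℝ))
      < ((c.N : ℝ) + 1) * c.DDW := by exact_mod_cast hlt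
  have hge' : (0 : ℝ) ≤ (c.DDW : ℝ) + (coeffSum (APolyG c.n c.d c.A) : ℝ) + c.B11 + (coeffSum P.FP : ℝ) := by
    exact_mod_cast hge
  rw [hAv, hFv] at hlt' hge'
  have hW : (0 : ℝ) < Wfac c.d := by exact_mod_cast Wfac_pos c.d
  have hD : (0 : ℝ) < 2 ^ (2 * c.S) := pow_pos (by norm_num) _
  have hDDW : (c.DDW : ℝ) = 2 ^ (2 * c.S) * (Wfac c.d : ℝ) := by simp [Cert3.DDW]
  rw [hDDW] at hlt' hge' ⊢
  have hDW : (0 : ℝ) < 2 ^ (2 * c.S) * (Wfac c.d : ℝ) := mul_pos hD hW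
  generalize AvalG c.n c.A 1 = AV at *
  generalize Fval3 c.F 1 1 1 = FV at *
  have e : (1 : ℝ) + AV / 2 ^ (2 * c.S) + (c.B11 : ℝ) / (2 ^ (2 * c.S) * Wfac c.d) + FV / 2 ^ (2 * c.S) =
      (2 ^ (2 * c.S) * (Wfac c.d : ℝ) + Wfac c.d * AV + c.B11 + Wfac c.d * FV) / (2 ^ (2 * c.S) * Wfac c.d) := by
    field_simp
  rw [e]
  constructor
  · rw [div_lt_iff₀ hDW]; linarith
  · exact div_nonneg hge' hDW.le

/-- **The bound from a checked `S²` certificate in Bachoc–Vallentin's multiplier set** (Theorem 4.2,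
`n = 3`, angle `s = p/q`, three-point kernels = Chebyshev `Q3`): if the side conditions
(`checkSide33`), the expansions (`PolysOK33`), the polynomial checks `checkI3` / `checkII3S2` and
the numerical bound all pass, every finite set of unit vectors of `ℝ³` with pairwise inner products
`≤ p/q` has at most `N` elements. With `N = M - 1` this is the certified Tammes reading
`θ(M) ≤ arccos(p/q)` of the cell's tables. -/
theorem card_le_of_cert33S2 (c : Cert3) (P : CertPolys3) {g0 g1 g2 g3 g4 q0 q1 : GramBlk}
    (hP : PolysOK33 c P g0 g1 g2 g3 g4 q0 q1) (hI : checkI3 c P = true)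
    (hII : checkII3S2 c P = true) (hs : checkSide33 c = true) (hb : checkBound3 c P = true)
    (C : Finset (EuclideanSpace ℝ (Fin 3))) (hC : ∀ x ∈ C, ‖x‖ = 1)
    (hcode : ∀ x ∈ C, ∀ y ∈ C, x ≠ y → inner ℝ x y ≤ (c.p : ℝ) / c.q) : C.card ≤ c.N := by
  obtain ⟨hn, hq, hpq, _, hAlen, hFk, _⟩ := side33_of_check c hs
  have hbd := bound33_of_check c P hP.hF hs hb
  have hAF := fun u hu hu' => AF33_of_check c P hP hI hs u hu hu'
  rw [hn] at hbd hAF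
  have hD : (0 : ℝ) < 2 ^ (2 * c.S) := pow_pos (by norm_num) _
  have hA : 0 ≤ BachocVallentin.pairSum C (fun u => AvalG 3 c.A u / 2 ^ (2 * c.S)) := by
    have h0 := pairSum_AvalG_nonneg (le_refl 3) c.A C hC
    unfold BachocVallentin.pairSum at h0 ⊢
    have e : (∑ x ∈ C, ∑ y ∈ C, AvalG 3 c.A (inner ℝ x y) / 2 ^ (2 * c.S)) =
        (∑ x ∈ C, ∑ y ∈ C, AvalG 3 c.A (inner ℝ x y)) / 2 ^ (2 * c.S) := by
      rw [Finset.sum_div]; refine Finset.sum_congr rfl fun x _ => ?_; rw [Finset.sum_div]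
    rw [e]; exact div_nonneg h0 hD.le
  have hF : 0 ≤ BachocVallentin.tripleSum C (fun u v t => Fval3 c.F u v t / 2 ^ (2 * c.S)) := by
    have h0 := tripleSum_Fval3_nonneg c.F C hC
    unfold BachocVallentin.tripleSum at h0 ⊢
    have e : (∑ x ∈ C, ∑ y ∈ C, ∑ z ∈ C,
        Fval3 c.F (inner ℝ x y) (inner ℝ x z) (inner ℝ y z) / 2 ^ (2 * c.S))
        = (∑ x ∈ C, ∑ y ∈ C, ∑ z ∈ C,
          Fval3 c.F (inner ℝ x y) (inner ℝ x z) (inner ℝ y z)) / 2 ^ (2 * c.S) := by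
      rw [Finset.sum_div]; refine Finset.sum_congr rfl fun x _ => ?_
      rw [Finset.sum_div]; refine Finset.sum_congr rfl fun y _ => ?_
      rw [Finset.sum_div]
    rw [e]; exact div_nonneg h0 hD.le
  have h := BachocVallentin.card_le_of_threePoint ((c.p : ℝ) / c.q) C hC hcode
    (fun u => AvalG 3 c.A u / 2 ^ (2 * c.S)) (fun u v t => Fval3 c.F u v t / 2 ^ (2 * c.S))
    ((c.B11 : ℝ) / c.DDW) ((c.B12 : ℝ) / c.DDW) ((c.B22 : ℝ) / c.DDW) hA hF
    (fun u v t => by rw [Fval3_swap12])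
    (fun u v t => by rw [Fval3_swap23])
    (bquad33_nonneg_of_check c hs)
    hAF
    (fun u v t hu hu' hv hv' ht ht' hp =>
      FII33S2_of_check c P hP hII hs u v t hu hu' hv hv' ht ht' hp)
    hbd.2
  have hlt : (C.card : ℝ) < (c.N : ℝ) + 1 := lt_of_le_of_lt h hbd.1
  have hlt' : C.card < c.N + 1 := by exact_mod_cast hlt
  omega

end Summit.Ventures.PackingBounds.ThreePointCert

end
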